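import Summits.BirchSwinnertonDyer.BirchSwinnertonDyer.Theorems.ClassRecordThreeEulerHalvesAtThreeWalkRowDuality
import Summits.BirchSwinnertonDyer.BirchSwinnertonDyer.Theorems.ClassRecordThreeEulerHalvesAtThreeWalkSupplyTransverse
import Summits.BirchSwinnertonDyer.BirchSwinnertonDyer.Theorems.Rank1ResidualJetWeilDatum
import HarnessLib

/-!
# The supply's duality conjuncts `hC` ∧ `hdual_q` ∧ `hdual_ℓ` for the GLOBAL transverse family, with
# the Weil datum and `τ² = 1` DISCHARGED and the transverse local facts taken in bsd-jet's END-FORM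
# currency (cell `bsd-stepL`, seat `bsd-stepL-tam3-p1`, helper toward item 19109 `EulerHalvesAtThree`,
# registered stub `stub_supplyAtThree`)

HONEST FRAMING. Nothing here proves BSD, J₃ or any divisibility of a Heegner point; no stub is
discharged; no item closes; 0 classes move (T7); `--supports stmt-BirchSwinnertonDyer-19109` (helper).

WHAT THIS FILE DOES. `Walk.exists_dualityConjuncts_of_rowDuality` (p516936) returns the three duality
conjuncts of the supply displays from bsd-jet's Poitou–Tate packages, GIVEN a `τ`-equivariant Weil
datum, `τ² = 1`, the level instances, and the local inputs `h𝒯σ`/`h𝒯sd` for the family `𝒯` at the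
places of every admissible conductor. Here, for the GLOBAL intrinsic transverse family of
`…WalkSupplyTransverse` (p520448):
* the Weil datum is bsd-jet's THEOREM `exists_weilDatum_liftAut` (p511679), `τ² = 1` holds in
  `Aut(K/ℚ)` for `K` imaginary quadratic, the instances `NeZero (p^k)`, `Finite E[p^k](K̄)` are supplied;
* `h𝒯σ`/`h𝒯sd` are TRANSFERRED from bsd-jet's END-FORM local facts about the per-conductor families
  (`globalTransverse_conjActPlace_mem`, `globalTransverse_dualTransported_eq`), taken here as
  hypotheses ALREADY SPECIALISED to the frame (the ∀-closed END-FORM statements instantiate them);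
so that `exists_dualityConjuncts_of_localFacts : hPT → h𝒯σ-fact → h𝒯sd-fact → hloc → (carrier data:
𝒮, v₀, (δ)) → ∃ C', hC ∧ hdual_q ∧ hdual_ℓ` — the carrier data being exactly the output of
`…WalkSupplyCarrier.exists_stringentCarrier` ∕ `exists_kummerCarrier`.
References (locators only; no cited FACT is declared): [cite: Jetchev2008, Thm. 5.1, Lemma 5.2,
proof of Thm. 5.2 (pp. 821–823), §3.1.2] [cite: MilneADT2006, Ch. I, Thm. 4.10(b)]
[cite: SilvermanAEC2009, Prop. III.8.1] [cite: Howard2004HeegnerKolyvagin, Prop. 2.1.9 (ii)].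
Design: one theorem, no definitions; `K : Type`. Axioms: `propext`, `Classical.choice`, `Quot.sound`.
-/

set_option autoImplicit false

noncomputable section

open scoped Classical Pointwise
open Function NumberField IsDedekindDomain WeierstrassCurve Field
open Literature.NumberTheory.EllipticCurves Literature.NumberTheory.GaloisRepresentations
open Literature.NumberTheory.EllipticCurves.Jetchev2008
open Literature.NumberTheory.GaloisCohomology Literature.NumberTheory.Automorphic
open Literature.NumberTheory.GaloisRepresentations.DiscreteGaloisModule (transverseSubgroup SelmerStructure)
open Summit.BirchSwinnertonDyer.Rank1Residual.JET.SelmerVocabulary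

namespace Summit.BirchSwinnertonDyer.Rank1Residual.JET.Walk

variable {K : Type} [Field K] [NumberField K] (W : WeierstrassCurve ℚ) [W.IsElliptic]
  [W.IsGloballyMinimal]

/-- **`τ² = 1` in `Aut(K/ℚ)` for `K` imaginary quadratic** (the group has order `2`). [folklore] -/
theorem algEquiv_mul_self_eq_one (hK : IsImaginaryQuadratic K) (τ : K ≃ₐ[ℚ] K) (hτ : τ ≠ 1) :
    τ * τ = 1 := by
  haveI : Algebra.IsQuadraticExtension ℚ K := ⟨hK.1⟩
  have hcard : Nat.card (K ≃ₐ[ℚ] K) = 2 := by rw [IsGalois.card_aut_eq_finrank, hK.1]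
  obtain ⟨y, -, hyu⟩ := (Nat.card_eq_two_iff' (1 : K ≃ₐ[ℚ] K)).mp hcard
  have h1 : τ = y := hyu τ hτ
  have h2 : τ⁻¹ = y := hyu τ⁻¹ (inv_ne_one.mpr hτ)
  rw [mul_eq_one_iff_eq_inv]
  exact h1.trans h2.symm

/-- **The supply's `hC` ∧ `hdual_q` ∧ `hdual_ℓ` for the GLOBAL transverse family, from named print
(`hPT`), the END-FORM transverse local facts (`h𝒯σ`, `h𝒯sd`, specialised to the frame), Lemma 5.2
(i)–(ii) (`hloc`), and carrier data (`𝒮`, `v₀`, (δ))** — `Walk.exists_dualityConjuncts_of_rowDuality`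
with the Weil datum (`exists_weilDatum_liftAut`), `τ² = 1` and the level instances discharged. The
conclusion is p516936's VERBATIM. [cite: Jetchev2008, Thm. 5.1, Lemma 5.2, proof of Thm. 5.2
(pp. 821–823)] [cite: MilneADT2006, Ch. I, Thm. 4.10(b)] [cite: SilvermanAEC2009, Prop. III.8.1] -/
theorem exists_dualityConjuncts_of_localFacts (hPT : poitouTate_selmerStructure_duality_conj K)
    (hK : IsImaginaryQuadratic K) (ι : K →+* ℂ) [∀ j : ℕ, NumberField (ringClassField K ι j)]
    (τ : K ≃ₐ[ℚ] K) (hτ : τ ≠ 1) (p k : ℕ) [Fact p.Prime] (hp2 : p ≠ 2) (hk : 1 ≤ k)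
    {𝒯 : SelmerStructure ((W.baseChange K).torsionGaloisModule ((p ^ k : ℕ) : ℤ))}
    (h𝒯 : ∀ v : HeightOneSpectrum (𝓞 K), 𝒯 (Sum.inr v) =
      ⨅ (ℓ : ℕ) (_ : ℓ.Prime ∧ (ℓ : 𝓞 K) ∈ v.asIdeal),
        ⨅ (w' : HeightOneSpectrum (𝓞 (ringClassField K ι ℓ)))
          (_ : w'.asIdeal.LiesOver v.asIdeal),
          letI := (adicCompletionOfLiesOver K (ringClassField K ι ℓ) v w').toAlgebra
          transverseSubgroup (GaloisRep.toLocal v ((W.baseChange K).torsionGaloisModule ((p ^ k : ℕ) : ℤ)))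
            (w'.adicCompletion (ringClassField K ι ℓ)))
    -- END-FORM local fact `h𝒯σ` (Gross §3 dihedral), specialised to the frame
    (h𝒯σ : ∀ (c : ℕ), Squarefree c → (∀ ℓ ∈ c.primeFactors,
        Zhang2014.IsKolyvaginPrime (W.conductorNorm ℤ) W K p ℓ ∧ k ≤ Zhang2014.kolyvaginIndex W p ℓ) →
      ∀ (𝒯c : SelmerStructure ((W.baseChange K).torsionGaloisModule ((p ^ k : ℕ) : ℤ))),
      (∀ v : HeightOneSpectrum (𝓞 K), 𝒯c (Sum.inr v) =
        ⨅ ℓ ∈ c.primeFactors.filter (fun ℓ : ℕ ↦ ((ℓ : ℕ) : 𝓞 K) ∈ v.asIdeal),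
          ⨅ (w' : HeightOneSpectrum (𝓞 (ringClassField K ι ℓ))) (_ : w'.asIdeal.LiesOver v.asIdeal),
            letI := (adicCompletionOfLiesOver K (ringClassField K ι ℓ) v w').toAlgebra
            transverseSubgroup (GaloisRep.toLocal v ((W.baseChange K).torsionGaloisModule ((p ^ k : ℕ) : ℤ)))
              (w'.adicCompletion (ringClassField K ι ℓ))) →
      ∀ (v w : HeightOneSpectrum (𝓞 K)) (h : τ • v = w), v ∈ placesDividing K c →
      ∀ x : galoisCohomology (((W.baseChange K).torsionGaloisModule ((p ^ k : ℕ) : ℤ)).toLocal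
        (Sum.inr v : Place K)) 1,
      x ∈ 𝒯c (Sum.inr v) → conjActPlace W τ ((p ^ k : ℕ) : ℤ) h x ∈ 𝒯c (Sum.inr w))
    -- END-FORM local fact `h𝒯sd` (Howard 2.1.9 (ii)), specialised to the frame
    (h𝒯sd : ∀ [NeZero (p ^ k)] [Finite (geomTorsion (W.baseChange K) ((p ^ k : ℕ) : ℤ))],
      ∀ (c : ℕ), Squarefree c → (∀ ℓ ∈ c.primeFactors,
        Zhang2014.IsKolyvaginPrime (W.conductorNorm ℤ) W K p ℓ ∧ k ≤ Zhang2014.kolyvaginIndex W p ℓ) →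
      ∀ (𝒯c : SelmerStructure ((W.baseChange K).torsionGaloisModule ((p ^ k : ℕ) : ℤ))),
      (∀ v : HeightOneSpectrum (𝓞 K), 𝒯c (Sum.inr v) =
        ⨅ ℓ ∈ c.primeFactors.filter (fun ℓ : ℕ ↦ ((ℓ : ℕ) : 𝓞 K) ∈ v.asIdeal),
          ⨅ (w' : HeightOneSpectrum (𝓞 (ringClassField K ι ℓ))) (_ : w'.asIdeal.LiesOver v.asIdeal),
            letI := (adicCompletionOfLiesOver K (ringClassField K ι ℓ) v w').toAlgebra
            transverseSubgroup (GaloisRep.toLocal v ((W.baseChange K).torsionGaloisModule ((p ^ k : ℕ) : ℤ)))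
              (w'.adicCompletion (ringClassField K ι ℓ))) →
      ∀ (e : geomTorsion (W.baseChange K) ((p ^ k : ℕ) : ℤ) →
          geomTorsion (W.baseChange K) ((p ^ k : ℕ) : ℤ) → AlgebraicClosure K)
        (hμ : ∀ S T, e S T ^ (p ^ k) = 1)
        (hadd₁ : ∀ S₁ S₂ T, e (S₁ + S₂) T = e S₁ T * e S₂ T)
        (hadd₂ : ∀ S T₁ T₂, e S (T₁ + T₂) = e S T₁ * e S T₂)
        (hgal : ∀ (g : absoluteGaloisGroup K) (S T : geomTorsion (W.baseChange K) ((p ^ k : ℕ) : ℤ)),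
          g • e S T = e (g • S) (g • T)),
      (∀ T, e T T = 1) → (∀ T, (∀ S, e S T = 1) → T = 0) →
      ∀ inv : LocalInvariants K (p ^ k), inv.IsPerfect → ∀ v ∈ placesDividing K c,
      inv.dualTransported 𝒯c (weilDualIntertwining (W.baseChange K) (p ^ k) e hμ hadd₁ hadd₂ hgal)
        (Sum.inr v) = 𝒯c (Sum.inr v))
    -- LOCAL PRINT-TO-TYPE (Lemma 5.2 (i)–(ii)) at the Kolyvagin primes of index `≥ k`
    (hloc : ∀ ℓ : ℕ, Zhang2014.IsKolyvaginPrime (W.conductorNorm ℤ) W K p ℓ →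
      k ≤ Zhang2014.kolyvaginIndex W p ℓ →
      ∀ (v : HeightOneSpectrum (𝓞 K)), (ℓ : 𝓞 K) ∈ v.asIdeal → ∀ (hfix : τ • v = v)
        (s : ℤ), s = 1 ∨ s = -1 →
      ((W.baseChange K).kummerSelmerStructure ((p ^ k : ℕ) : ℤ) (Sum.inr v)).relIndex
        ((conjActPlace W τ ((p ^ k : ℕ) : ℤ) hfix - s • AddMonoidHom.id _).ker) = p ^ k)
    (eb : ℕ → Bool) (n : ℕ)
    -- carrier data
    (𝒮 : SelmerStructure ((W.baseChange K).torsionGaloisModule ((p ^ k : ℕ) : ℤ)))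
    (hS : ∀ v, 𝒮 v ≤ (W.baseChange K).kummerSelmerStructure ((p ^ k : ℕ) : ℤ) v)
    (v₀ : HeightOneSpectrum (𝓞 K)) (hv₀ : τ • v₀ ≠ v₀)
    (hv₀N : ((W.conductorNorm ℤ : ℕ) : 𝓞 K) ∈ v₀.asIdeal)
    (h𝒮σ : ∀ (v w : HeightOneSpectrum (𝓞 K)) (h : τ • v = w), v ∈ ({v₀, τ • v₀} : Finset _) →
      ∀ x : galoisCohomology (((W.baseChange K).torsionGaloisModule ((p ^ k : ℕ) : ℤ)).toLocal
        (Sum.inr v : Place K)) 1,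
      x ∈ 𝒮 (Sum.inr v) → conjActPlace W τ ((p ^ k : ℕ) : ℤ) h x ∈ 𝒮 (Sum.inr w))
    {t : ℕ}
    (hcyc : IsAddCyclic (↥((W.baseChange K).kummerSelmerStructure ((p ^ k : ℕ) : ℤ) (Sum.inr v₀)) ⧸
      (𝒮 (Sum.inr v₀)).addSubgroupOf
        ((W.baseChange K).kummerSelmerStructure ((p ^ k : ℕ) : ℤ) (Sum.inr v₀))))
    (hidx : (𝒮 (Sum.inr v₀)).relIndex
      ((W.baseChange K).kummerSelmerStructure ((p ^ k : ℕ) : ℤ) (Sum.inr v₀)) = p ^ t) :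
    ∃ C' : ℕ → AddSubgroup (galoisCohomology ((W.baseChange K).torsionGaloisModule ((p ^ k : ℕ) : ℤ)) 1),
      (∀ m, C' m ≤ signPart W K τ ((p ^ k : ℕ) : ℤ) (if !eb m then 1 else -1) ⊤) ∧
      (∀ s : {m : ℕ // Squarefree m ∧ ∀ q ∈ m.primeFactors,
          Zhang2014.IsKolyvaginPrime (W.conductorNorm ℤ) W K p q ∧ k ≤ Zhang2014.kolyvaginIndex W p q},
        n ∣ s.1 → ∃ (Qg Qg' : Type) (_ : AddCommGroup Qg) (_ : AddCommGroup Qg') (_ : Finite Qg')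
          (locq : signPart W K τ ((p ^ k : ℕ) : ℤ) (if !eb s.1 then 1 else -1)
              (selmerF W ((p ^ k : ℕ) : ℤ) 𝒯 (placesDividing K s.1)).selmerGroup →+ Qg)
          (locq' : C' s.1 →+ Qg'),
          (∀ x : C' s.1, locq' x = 0 ↔
            (x : galoisCohomology ((W.baseChange K).torsionGaloisModule ((p ^ k : ℕ) : ℤ)) 1) ∈
              signPart W K τ ((p ^ k : ℕ) : ℤ) (if !eb s.1 then 1 else -1)
                (selmerF W ((p ^ k : ℕ) : ℤ) 𝒯 (placesDividing K s.1)).selmerGroup) ∧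
          Nat.card locq.range * Nat.card locq'.range = Nat.card Qg' ∧ IsAddCyclic Qg' ∧
          Nat.card Qg' = p ^ t) ∧
      (∀ (s : {m : ℕ // Squarefree m ∧ ∀ q ∈ m.primeFactors,
          Zhang2014.IsKolyvaginPrime (W.conductorNorm ℤ) W K p q ∧ k ≤ Zhang2014.kolyvaginIndex W p q})
        (ℓ : ℕ), Zhang2014.IsKolyvaginPrime (W.conductorNorm ℤ) W K p ℓ →
        k ≤ Zhang2014.kolyvaginIndex W p ℓ → ¬ ℓ ∣ s.1 → (∀ q ∈ s.1.primeFactors, q < ℓ) → n ∣ s.1 →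
        ∀ v : HeightOneSpectrum (𝓞 K), (ℓ : 𝓞 K) ∈ v.asIdeal →
        ∃ (Sg : Type) (_ : AddCommGroup Sg)
          (sing : signPart W K τ ((p ^ k : ℕ) : ℤ) (if !eb s.1 then 1 else -1)
              (((selmerF0 W ((p ^ k : ℕ) : ℤ) 𝒯 𝒮 (placesDividing K s.1) {v₀, τ • v₀}).relaxedAt
                {v}).selmerGroup) →+ Sg),
          (∀ x, sing x = 0 ↔
            (x : galoisCohomology ((W.baseChange K).torsionGaloisModule ((p ^ k : ℕ) : ℤ)) 1) ∈
              signPart W K τ ((p ^ k : ℕ) : ℤ) (if !eb s.1 then 1 else -1)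
                ((selmerF0 W ((p ^ k : ℕ) : ℤ) 𝒯 𝒮 (placesDividing K s.1) {v₀, τ • v₀}).selmerGroup)) ∧
          Nat.card sing.range *
            Nat.card ((C' s.1).map (galoisCohomology.localization
              ((W.baseChange K).torsionGaloisModule ((p ^ k : ℕ) : ℤ)) (Sum.inr v) 1)) = p ^ k) := by
  have hp : p.Prime := Fact.out
  -- instances at level `p^k`
  haveI : NeZero (p ^ k) := ⟨pow_ne_zero k hp.ne_zero⟩
  haveI : Finite (geomTorsion (W.baseChange K) ((p ^ k : ℕ) : ℤ)) :=
    finite_geomTorsion_of_neZero (W.baseChange K) (p ^ k)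
  -- `τ² = 1`
  have hτ2 : τ * τ = 1 := algEquiv_mul_self_eq_one hK τ hτ
  -- the `τ`-equivariant Weil datum on `E[p^k]/K` (bsd-jet, THEOREM)
  have h2 : 2 ≤ p ^ k := by
    calc 2 ≤ p := hp.two_le
      _ = p ^ 1 := (pow_one p).symm
      _ ≤ p ^ k := Nat.pow_le_pow_right hp.pos hk
  obtain ⟨e, hμ, hadd₁, hadd₂, hgal, halt, hnondeg, hτe⟩ := exists_weilDatum_liftAut W τ (p ^ k) h2
  -- the transverse local facts for the GLOBAL family at the places of every admissible conductor
  have h𝒯σ' : ∀ (s : {m : ℕ // Squarefree m ∧ ∀ q ∈ m.primeFactors,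
        Zhang2014.IsKolyvaginPrime (W.conductorNorm ℤ) W K p q ∧ k ≤ Zhang2014.kolyvaginIndex W p q})
      (v w : HeightOneSpectrum (𝓞 K)) (h : τ • v = w), v ∈ placesDividing K s.1 →
      ∀ x : galoisCohomology (((W.baseChange K).torsionGaloisModule ((p ^ k : ℕ) : ℤ)).toLocal
        (Sum.inr v : Place K)) 1,
      x ∈ 𝒯 (Sum.inr v) → conjActPlace W τ ((p ^ k : ℕ) : ℤ) h x ∈ 𝒯 (Sum.inr w) :=
    fun s v w h hv x hx ↦ globalTransverse_conjActPlace_mem h𝒯 τ s.2.1 (h𝒯σ s.1 s.2.1 s.2.2) v w h hv x hx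
  have h𝒯sd' : ∀ (s : {m : ℕ // Squarefree m ∧ ∀ q ∈ m.primeFactors,
        Zhang2014.IsKolyvaginPrime (W.conductorNorm ℤ) W K p q ∧ k ≤ Zhang2014.kolyvaginIndex W p q})
      (inv : LocalInvariants K (p ^ k)), inv.IsPerfect → ∀ v ∈ placesDividing K s.1,
      inv.dualTransported 𝒯 (weilDualIntertwining (W.baseChange K) (p ^ k) e hμ hadd₁ hadd₂ hgal)
        (Sum.inr v) = 𝒯 (Sum.inr v) :=
    fun s inv hperf v hv ↦ globalTransverse_dualTransported_eq (ι := ι) h𝒯 s.2.1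
      (fun 𝒯c h𝒯c ↦ h𝒯sd s.1 s.2.1 s.2.2 𝒯c h𝒯c e hμ hadd₁ hadd₂ hgal halt hnondeg) inv hperf v hv
  exact exists_dualityConjuncts_of_rowDuality W τ p k e hμ hadd₁ hadd₂ hgal halt hnondeg hτe hPT hτ2 hp2
    hk 𝒯 𝒮 eb n h𝒯σ' h𝒯sd' hS v₀ hv₀ hv₀N h𝒮σ hcyc hidx hloc

end Summit.BirchSwinnertonDyer.Rank1Residual.JET.Walk

end
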